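import Literature.NumberTheory.EllipticCurves.BSDRootNumber
import Literature.NumberTheory.EllipticCurves.AnalyticRankEntireValueProofs
import Literature.NumberTheory.EllipticCurves.RohrlichAnticyclotomicNonvanishing
import HarnessLib

/-!
# The root number of a CM (or any) elliptic curve over `ℚ` IS the weight-two root number of a Hecke
# character with the same `L`-function — a PROVED bridge `WeierstrassCurve.HasFunctionalEquationSign`
# ⟹ `IsCentralRootNumber` (0 definitions, 0 facts)

Topic `NumberTheory/EllipticCurves`. Cell `bsd-cm`, K7r line `rubin-formula-zp` (crux
stmt-BirchSwinnertonDyer-19945) via the typing layer (seat bsd-littype-10, gen 5): the Rubin-type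
`p`-adic `L`-function datum `BurungaleKobayashiNakamuraOta2026.RubinPadicLFunctionData` (file
`BurungaleKobayashiNakamuraOta2026/RubinPadicLFunction.lean`) reads [BKNO] Thm. 7.2 at the trivial
character under the hypothesis `IsCentralRootNumber φ (−1)` ("`ε(φ) = −1`", the tree's weight-two root
number predicate of `RohrlichAnticyclotomicNonvanishing.lean`: an entire `Λ(s) = Γ(s) B^s L(φ, s)` with
`Λ(s) = W Λ(2−s)`), while the K7r frame knows the curve-side sign `W.rootNumber = −1`
(`WeierstrassCurve.HasFunctionalEquationSign (−1)`: an entire continuation of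
`N^{s/2}(2π)^{−s}Γ(s)L(E,s)` with `Λ(2−s) = −Λ(s)`). When `L(φ, s) = L(E/ℚ, s)` on `re s > 3/2` (Deuring;
the pinning clause `∀ s, 3/2 < re s → heckeLFunction φ s = W.LSeries s` carried by every consumer), the
two completed `L`-functions are the SAME entire function with `B = √N/(2π)`, so the two signs agree.
This file proves exactly that (pure bookkeeping of complex powers; no arithmetic input):

* `cpow_half_mul_twoPi_cpow_neg` — `N^{s/2} · (2π)^{−s} = (√N/(2π))^s` for a natural number `N > 0`;
* `isCentralRootNumber_of_hasFunctionalEquationSign` — `HasFunctionalEquationSign ε` + the pinning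
  clause ⟹ `IsCentralRootNumber φ ε` (any `ε : ℤ`);
* `isCentralRootNumber_neg_one_of_rootNumber_eq_neg_one` — the K7r instance (`w(E) = −1`).

Silverman, *AEC*, C.16 (`Λ_E(s) = N^{s/2}(2π)^{−s}Γ(s)L(E,s)`, `Λ_E(2−s) = w Λ_E(s)`); Jia 2026 §2 (3)–(5)
(`Λ(s,χ) = Γ(s)(Af)^s L(s,χ)`, `A = (2π)⁻¹|d_K|^{1/2}`, `f = N𝔣(χ)^{1/2}`; for the Hecke character of a CM
curve `|d_K| N𝔣 = N_E`, Deuring). Nothing about BSD.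
-/

noncomputable section

open scoped Classical

open Literature.NumberTheory.GaloisRepresentations

namespace Literature.NumberTheory.EllipticCurves

/-! ## §1. The archimedean prefactors agree: `N^{s/2}(2π)^{−s} = (√N/(2π))^s` -/

/-- For a natural number `N > 0` and every `s : ℂ`: `N^{s/2} · (2π)^{−s} = (√N/(2π))^s` (all three complex
powers of POSITIVE REALS, i.e. `exp` of real logarithms times `s`): the two printed normalisations
`ξ_E(s) = N^{s/2}(2π)^{−s}Γ(s)L_E(s)` (Silverman AEC C.16) and `Λ(s,χ) = Γ(s)(Af)^s L(s,χ)`,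
`A f = (2π)⁻¹ (|d_K| N𝔣)^{1/2}` (Jia 2026 §2 (3)–(5)) of the same completed `L`-function agree.
[cite: SilvermanAEC2009, C.16 pp. 450–451 (ξ_E and Thm. 16.3)] [cite: Jia2026ActaArith, §2 (3)–(5)] -/
theorem cpow_half_mul_twoPi_cpow_neg {N : ℕ} (hN : 0 < N) (s : ℂ) :
    (N : ℂ) ^ (s / 2) * (2 * Real.pi : ℂ) ^ (-s) =
      ((Real.sqrt N / (2 * Real.pi) : ℝ) : ℂ) ^ s := by
  have hNr : (0 : ℝ) < N := by exact_mod_cast hN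
  have h2π : (0 : ℝ) < 2 * Real.pi := by positivity
  have hB : (0 : ℝ) < Real.sqrt N / (2 * Real.pi) := div_pos (Real.sqrt_pos.2 hNr) h2π
  have hNc : (N : ℂ) ≠ 0 := by exact_mod_cast hN.ne'
  have h2πc : (2 * Real.pi : ℂ) ≠ 0 := by
    rw [show (2 * Real.pi : ℂ) = ((2 * Real.pi : ℝ) : ℂ) by push_cast; ring]
    exact_mod_cast h2π.ne'
  have hBc : ((Real.sqrt N / (2 * Real.pi) : ℝ) : ℂ) ≠ 0 := by exact_mod_cast hB.ne'
  rw [Complex.cpow_def_of_ne_zero hNc, Complex.cpow_def_of_ne_zero h2πc,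
    Complex.cpow_def_of_ne_zero hBc, ← Complex.exp_add]
  congr 1
  have hlogN : Complex.log (N : ℂ) = ((Real.log N : ℝ) : ℂ) := by
    rw [← Complex.ofReal_natCast, ← Complex.ofReal_log hNr.le]
  have hlog2π : Complex.log (2 * Real.pi : ℂ) = ((Real.log (2 * Real.pi) : ℝ) : ℂ) := by
    rw [show (2 * Real.pi : ℂ) = ((2 * Real.pi : ℝ) : ℂ) by push_cast; ring,
      ← Complex.ofReal_log h2π.le]
  have hlogB : Complex.log ((Real.sqrt N / (2 * Real.pi) : ℝ) : ℂ) =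
      ((Real.log N / 2 - Real.log (2 * Real.pi) : ℝ) : ℂ) := by
    rw [← Complex.ofReal_log hB.le, Real.log_div (Real.sqrt_pos.2 hNr).ne' h2π.ne',
      Real.log_sqrt hNr.le]
  rw [hlogN, hlog2π, hlogB]
  push_cast
  ring

/-! ## §2. The bridge -/

variable {K : Type} [Field K] [NumberField K]

/-- **`W.HasFunctionalEquationSign ε` ⟹ `IsCentralRootNumber φ ε`** for a Hecke character `φ` (of any
number field `K`) whose `L`-function IS `L(W, s)` on `re s > 3/2`: the entire continuation `Λ` of
`N^{s/2}(2π)^{−s}Γ(s)L(W,s)` witnessing the curve's functional equation `Λ(2−s) = εΛ(s)` is the witness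
`Λ(s) = Γ(s) B^s L(φ,s)`, `B = √N/(2π) > 0`, of the weight-two root number `ε` of `φ`
(`W.entireLFunction = W.LSeries` on `re s > 3/2` in either branch of its definition). PROVED.
[cite: SilvermanAEC2009, C.16 Thm. 16.3 (p. 451)] [cite: Jia2026ActaArith, §2 (3)–(5)] -/
theorem isCentralRootNumber_of_hasFunctionalEquationSign (W : WeierstrassCurve ℚ) [W.IsElliptic]
    {φ : HeckeCharacter K} (hL : ∀ s : ℂ, 3 / 2 < s.re → heckeLFunction φ s = W.LSeries s) {ε : ℤ}
    (hε : W.HasFunctionalEquationSign ε) : IsCentralRootNumber φ (ε : ℂ) := by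
  obtain ⟨Λ, ⟨hΛd, hΛeq⟩, hFE⟩ := hε
  have hN : 0 < W.conductorNorm ℤ := W.conductorNorm_pos_holds
  have hLS : ∀ s : ℂ, (3 / 2 : ℝ) < s.re → W.entireLFunction s = W.LSeries s := by
    intro s hs
    by_cases h : W.HasEntireLFunction
    · exact W.entireLFunction_eq_LSeries h hs
    · rw [W.entireLFunction_eq_LSeries_of_not_hasEntireLFunction h]
  refine ⟨Real.sqrt (W.conductorNorm ℤ) / (2 * Real.pi),
    div_pos (Real.sqrt_pos.2 (by exact_mod_cast hN)) (by positivity), Λ, hΛd, ?_, ?_⟩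
  · intro s hs
    rw [hΛeq s hs, WeierstrassCurve.completedLFunction, hLS s hs, ← hL s hs,
      ← cpow_half_mul_twoPi_cpow_neg hN s]
    ring
  · intro s
    have h := hFE (2 - s)
    rw [sub_sub_cancel] at h
    exact h

/-- **The K7r instance**: `w(E) = −1` (`W.rootNumber = −1`) and `L(φ, s) = L(E/ℚ, s)` on `re s > 3/2` give
`IsCentralRootNumber φ (−1)` — the antecedent of `RubinPadicLFunctionData.thm72_one` ([BKNO] Thm. 7.2 at
`𝟙`: "`ε(ϕχ) = −1`" at `χ = 𝟙`). PROVED. [cite: SilvermanAEC2009, C.16 Thm. 16.3 (p. 451)] -/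
theorem isCentralRootNumber_neg_one_of_rootNumber_eq_neg_one (W : WeierstrassCurve ℚ) [W.IsElliptic]
    {φ : HeckeCharacter K} (hL : ∀ s : ℂ, 3 / 2 < s.re → heckeLFunction φ s = W.LSeries s)
    (hw : W.rootNumber = -1) : IsCentralRootNumber φ (-1) := by
  have h := isCentralRootNumber_of_hasFunctionalEquationSign W hL
    ((rootNumber_eq_neg_one_iff W).1 hw)
  simpa using h

/-- Conversely-shaped bookkeeping: with `w(E) = +1` read as `HasFunctionalEquationSign 1`, the Hecke
character has weight-two root number `+1` (the antecedent shape of [BKNO] Thm. 4.12 at `k = 0`, `χ = 𝟙`).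
PROVED. [cite: SilvermanAEC2009, C.16 Thm. 16.3 (p. 451)] -/
theorem isCentralRootNumber_one_of_hasFunctionalEquationSign_one (W : WeierstrassCurve ℚ)
    [W.IsElliptic] {φ : HeckeCharacter K}
    (hL : ∀ s : ℂ, 3 / 2 < s.re → heckeLFunction φ s = W.LSeries s)
    (h1 : W.HasFunctionalEquationSign 1) : IsCentralRootNumber φ 1 := by
  have h := isCentralRootNumber_of_hasFunctionalEquationSign W hL h1
  simpa using h

end Literature.NumberTheory.EllipticCurves

end
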